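import Summits.CriticalPhenomena.PercolationContinuityZ3.Theorems.PercNearOneGluingNoHeavyPcintSignedConfigPeelCount
import Mathlib.RingTheory.PowerSeries.Basic
import HarnessLib

/-!
# CriticalPhenomena/PercolationContinuityZ3 — Theorems/PercNearOneGluingNoHeavyPcintSignedConfigSeries.lean: the counting recursions as identities of GENERATING FUNCTIONS in `ℤ⟦X⟧`

Lane prim-pcint, STRUCTURE rule «numerics ⇒ structure ⇒ conjecture» (prim-pcint-2 GEN 22); sequel of …PcintSignedConfigPeelCount.  The counting
functions of the forest decomposition become power series in the size variable `X` (one `X` per point): `gS top W wP S` (prefixed classes), `eS S`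
(arches), `iS T` (items), `epS i S` (arches with `i` empty leading gaps, sizes `≥ i+2`).  The first-item recursion (…PcintSignedConfigCount) reads
  `gS top W wP S = C[S = []] + Σ_{k ≤ |S|} iS (S.take k) · Φ_k`,  `Φ_k = [CondOK_k(¬whole)]·(gS top W₂ wP₂ (S.drop k) − C[S.drop k = []]) + [CondOK_k(whole)]·C[…]`
(`gS_rec`), items are arches or single letters (`iS_eq`), and the gap recursion (…PcintSignedConfigPeelCount) reads
  `epS i S = Σ_{t ≤ |S|} fS (S.take t) · (epS (i+1) (S.drop t) + C([S.drop t = []]·#goodSet (Fin (i+2)))·X^{i+2})`  (`epS_rec`),  `eS = epS 0`.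

HONEST FRAMING: coefficient bookkeeping only.  No `sorry`; standard axioms.  Written by prim-pcint-2 gen 22 (prover-prim-pcint-2-g22-0), 2026-08-27.
-/

open PowerSeries

namespace Summit.CriticalPhenomena.PercolationContinuityZ3.Theorems.Pcint.ChordDiag

/-! ### The generating functions -/

/-- Generating function of the prefixed class `G(top, W, wP, S)` by number of points. [folklore] -/
noncomputable def gS (top : Bool) (W : List ℤ) (wP : Option ℤ) (S : List Bool) : ℤ⟦X⟧ := PowerSeries.mk fun N => (gCount top W wP S N : ℤ)

/-- Generating function of the class `F(T) = G(false, [], none, T)` (no closed interval of weight zero). [folklore] -/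
noncomputable def fS (T : List Bool) : ℤ⟦X⟧ := gS false [] none T

/-- Generating function of the arch class `E(S)`. [folklore] -/
noncomputable def eS (S : List Bool) : ℤ⟦X⟧ := PowerSeries.mk fun N => (eCount S N : ℤ)

/-- Generating function of the items with sign word `T`. [folklore] -/
noncomputable def iS (T : List Bool) : ℤ⟦X⟧ := PowerSeries.mk fun N => (iCount T N : ℤ)

/-- Generating function of the arches with `i` empty leading gaps, sizes `≥ i + 2`. [folklore] -/
noncomputable def epS (i : ℕ) (S : List Bool) : ℤ⟦X⟧ := PowerSeries.mk fun N => if i + 2 ≤ N then (epCount i S N : ℤ) else 0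

/-- The indicator constant `C[S = []]`. [folklore] -/
noncomputable def nilC (S : List Bool) : ℤ⟦X⟧ := if S = [] then 1 else 0

/-- Coefficients of `gS`. [folklore] -/
@[simp] theorem coeff_gS (top : Bool) (W : List ℤ) (wP : Option ℤ) (S : List Bool) (N : ℕ) :
    coeff N (gS top W wP S) = gCount top W wP S N := by
  simp [gS]

/-- Coefficients of `eS`. [folklore] -/
@[simp] theorem coeff_eS (S : List Bool) (N : ℕ) : coeff N (eS S) = eCount S N := by
  simp [eS]

/-- Coefficients of `iS`. [folklore] -/
@[simp] theorem coeff_iS (T : List Bool) (N : ℕ) : coeff N (iS T) = iCount T N := by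
  simp [iS]

/-- Coefficients of `epS`. [folklore] -/
@[simp] theorem coeff_epS (i : ℕ) (S : List Bool) (N : ℕ) : coeff N (epS i S) = if i + 2 ≤ N then (epCount i S N : ℤ) else 0 := by
  simp [epS]

/-- Coefficients of `nilC`. [folklore] -/
theorem coeff_nilC (S : List Bool) (N : ℕ) : coeff N (nilC S) = if N = 0 ∧ S = [] then 1 else 0 := by
  unfold nilC
  split_ifs with h1 h2 h3 <;> simp_all [coeff_one]

/-! ### Items are arches or single letters -/

/-- **`iS T = eS T + [|T| = 1]·X`.** [folklore] -/
theorem iS_eq (T : List Bool) : iS T = eS T + if T.length = 1 then X else 0 := by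
  ext N
  rw [map_add, coeff_iS, coeff_eS]
  rcases N with _ | _ | N
  · rw [iCount_zero, eCount_zero]; split_ifs <;> simp
  · rw [iCount_one, eCount_one]; split_ifs <;> simp
  · rw [iCount_add_two]; split_ifs <;> simp [coeff_X]

/-! ### The first-item recursion -/

/-- The condition `CondOK` only depends on `whole` up to equivalence. [folklore] -/
theorem condOK_congr {top : Bool} {W : List ℤ} {wP : Option ℤ} {v : ℤ} {P Q : Prop} (h : P ↔ Q) :
    CondOK top W wP v P ↔ CondOK top W wP v Q := by
  rw [propext h]

open Classical in
/-- The factor `Φ_k` of the first-item recursion. [folklore] -/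
noncomputable def gPhi (top : Bool) (W : List ℤ) (wP : Option ℤ) (S : List Bool) (k : ℕ) : ℤ⟦X⟧ :=
  (if CondOK top W wP (lwt (S.take k)) False then
      gS top (W2 W wP (lwt (S.take k))) (wP2 wP (lwt (S.take k))) (S.drop k) - nilC (S.drop k) else 0) +
    (if CondOK top W wP (lwt (S.take k)) True then nilC (S.drop k) else 0)

open Classical in
/-- **The first-item recursion as a generating-function identity.** [folklore] -/
theorem gS_rec (top : Bool) (W : List ℤ) (wP : Option ℤ) (S : List Bool) :
    gS top W wP S = nilC S + ∑ k ∈ Finset.range (S.length + 1), iS (S.take k) * gPhi top W wP S k := by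
  ext N
  rw [map_add, coeff_gS, map_sum, coeff_nilC]
  -- the coefficient of a product `iS · Φ`: the item has at least one point
  have hprod : ∀ k, coeff N (iS (S.take k) * gPhi top W wP S k) =
      ∑ N₁ ∈ Finset.Icc 1 N, (iCount (S.take k) N₁ : ℤ) * coeff (N - N₁) (gPhi top W wP S k) := by
    intro k
    rw [coeff_mul, Finset.Nat.sum_antidiagonal_eq_sum_range_succ
      (fun a b => coeff a (iS (S.take k)) * coeff b (gPhi top W wP S k)), Finset.range_eq_Ico]
    have h01 : Finset.Ico 0 (N + 1) = insert 0 (Finset.Icc 1 N) := by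
      ext a; simp only [Finset.mem_Ico, Finset.mem_insert, Finset.mem_Icc]; omega
    rw [h01, Finset.sum_insert (by simp), coeff_iS, iCount_zero]
    simp only [Nat.cast_zero, zero_mul, zero_add, coeff_iS]
  simp only [hprod]
  rcases Nat.eq_zero_or_pos N with hN | hN
  · subst hN
    simp [gCount_zero]
  · rw [gCount_succ top W wP S N hN, if_neg (by omega), zero_add, Nat.cast_sum, Finset.sum_comm]
    refine Finset.sum_congr rfl fun N₁ hN₁ => ?_
    rw [Finset.mem_Icc] at hN₁
    rw [Nat.cast_sum]
    refine Finset.sum_congr rfl fun k _ => ?_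
    unfold gTerm gPhi
    rw [map_add]
    by_cases hw : N₁ = N
    · -- the item is the whole word: `N - N₁ = 0`
      subst hw
      rw [Nat.sub_self]
      have e1 : ∀ P : Prop, coeff 0 (if P then gS top (W2 W wP (lwt (S.take k))) (wP2 wP (lwt (S.take k))) (S.drop k) - nilC (S.drop k)
          else 0) = 0 := fun P => by
        split_ifs
        · rw [map_sub, coeff_gS, coeff_nilC, gCount_zero]; simp
        · simp
      rw [e1, zero_add]
      by_cases hc : CondOK top W wP (lwt (S.take k)) (N₁ = N₁)
      · rw [if_pos hc, if_pos ((condOK_congr (iff_true_intro rfl)).1 hc), coeff_nilC, gCount_zero]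
        simp
      · rw [if_neg hc, if_neg (fun h => hc ((condOK_congr (iff_true_intro rfl)).2 h))]
        simp
    · have hlt : 1 ≤ N - N₁ := by omega
      have e2 : coeff (N - N₁) (nilC (S.drop k)) = 0 := by rw [coeff_nilC, if_neg (by omega)]
      have e3 : ∀ P : Prop, coeff (N - N₁) (if P then nilC (S.drop k) else 0) = 0 := fun P => by
        split_ifs
        · exact e2
        · simp
      rw [e3, add_zero]
      by_cases hc : CondOK top W wP (lwt (S.take k)) (N₁ = N)
      · rw [if_pos hc, if_pos ((condOK_congr (iff_false_intro hw)).1 hc), map_sub, coeff_gS, e2, sub_zero]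
        simp
      · rw [if_neg hc, if_neg (fun h => hc ((condOK_congr (iff_false_intro hw)).2 h))]
        simp


/-! ### A Boolean form of the item-level condition (for evaluation by `decide`) -/

/-- Boolean version of `CondOK`. [folklore] -/
def condOKb (top : Bool) (W : List ℤ) (wP : Option ℤ) (v : ℤ) (whole : Bool) : Bool :=
  (W.all fun w => w + v != 0) &&
    (match wP with
      | none => true
      | some w₀ => (top && whole) || (w₀ + v != 0)) &&
    ((v != 0) || (top && wP.isNone && whole))

/-- `CondOK` is decided by `condOKb`. [folklore] -/
theorem condOK_iff_b (top : Bool) (W : List ℤ) (wP : Option ℤ) (v : ℤ) (whole : Bool) :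
    CondOK top W wP v (whole = true) ↔ condOKb top W wP v whole = true := by
  unfold CondOK condOKb
  cases wP with
  | none =>
    cases top <;> cases whole <;> simp [List.all_eq_true]
  | some w₀ =>
    cases top <;> cases whole <;> simp [List.all_eq_true, and_assoc]

open Classical in
/-- The factor `Φ_k` in Boolean form. [folklore] -/
theorem gPhi_eq (top : Bool) (W : List ℤ) (wP : Option ℤ) (S : List Bool) (k : ℕ) :
    gPhi top W wP S k =
      (if condOKb top W wP (lwt (S.take k)) false = true then
          gS top (W2 W wP (lwt (S.take k))) (wP2 wP (lwt (S.take k))) (S.drop k) - nilC (S.drop k) else 0) +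
        (if condOKb top W wP (lwt (S.take k)) true = true then nilC (S.drop k) else 0) := by
  unfold gPhi
  have hF : CondOK top W wP (lwt (S.take k)) False ↔ condOKb top W wP (lwt (S.take k)) false = true :=
    (condOK_congr (by simp)).trans (condOK_iff_b top W wP _ false)
  have hT : CondOK top W wP (lwt (S.take k)) True ↔ condOKb top W wP (lwt (S.take k)) true = true :=
    (condOK_congr (by simp)).trans (condOK_iff_b top W wP _ true)
  simp only [hF, hT]

/-! ### The class `F` of the empty word -/

/-- `fS [] = 1`: only the empty configuration has no letters and no closed interval of weight zero. [folklore] -/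
theorem fS_nil : fS [] = 1 := by
  ext N
  unfold fS
  rw [coeff_gS, coeff_one]
  rcases Nat.eq_zero_or_pos N with hN | hN
  · subst hN; simp [gCount_zero]
  · rw [gCount_succ false [] none [] N hN, if_neg (by omega)]
    simp only [List.length_nil, zero_add, Finset.range_one, Finset.sum_singleton, Nat.cast_eq_zero]
    refine Finset.sum_eq_zero fun N₁ _ => ?_
    unfold gTerm
    rw [if_neg, zero_mul]
    unfold CondOK
    simp [lwt]

/-! ### The gap recursion -/

/-- **The gap recursion as a generating-function identity.** [folklore] -/
theorem epS_rec (i : ℕ) (S : List Bool) :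
    epS i S = ∑ t ∈ Finset.range (S.length + 1),
      fS (S.take t) * (epS (i + 1) (S.drop t) + C ((if S.drop t = [] then ((goodSet (Fin (i + 2))).card : ℤ) else 0)) * X ^ (i + 2)) := by
  ext N
  rw [coeff_epS, map_sum]
  -- coefficient of each summand
  have hterm : ∀ t, coeff N (fS (S.take t) * (epS (i + 1) (S.drop t) +
      C ((if S.drop t = [] then ((goodSet (Fin (i + 2))).card : ℤ) else 0)) * X ^ (i + 2))) =
      ∑ p ∈ Finset.antidiagonal N, (gCount false [] none (S.take t) p.1 : ℤ) *
        (if i + 2 ≤ p.2 then (epCount (i + 1) (S.drop t) p.2 : ℤ) else 0) := by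
    intro t
    rw [coeff_mul]
    refine Finset.sum_congr rfl fun p _ => ?_
    unfold fS
    rw [coeff_gS, map_add, coeff_epS, PowerSeries.coeff_C_mul_X_pow]
    congr 1
    have hb : (epCount (i + 1) (S.drop t) (i + 2) : ℤ) = if S.drop t = [] then ((goodSet (Fin (i + 2))).card : ℤ) else 0 := by
      rw [show i + 2 = (i + 1) + 1 from rfl, epCount_base]; split_ifs <;> simp
    by_cases h3 : i + 3 ≤ p.2
    · have e1 : i + 1 + 2 ≤ p.2 := by omega
      have e2 : i + 2 ≤ p.2 := by omega
      have e3 : p.2 ≠ i + 2 := by omega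
      simp only [e1, e2, e3, if_true, if_false, add_zero]
    · by_cases h2 : p.2 = i + 2
      · rw [h2]
        have e1 : ¬(i + 1 + 2 ≤ i + 2) := by omega
        rw [if_neg e1, if_pos (le_refl _), zero_add, hb, if_pos rfl]
      · have e1 : ¬(i + 1 + 2 ≤ p.2) := by omega
        have e2 : ¬(i + 2 ≤ p.2) := by omega
        simp only [e1, e2, h2, if_false, add_zero]
  simp only [hterm]
  split_ifs with hN
  · rw [epCount_rec i S N hN]
    push_cast
    rw [Finset.sum_comm]
    refine Finset.sum_congr rfl fun t _ => ?_
    -- reindex `ℓ ↦ (ℓ, N − ℓ)`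
    rw [Finset.Nat.sum_antidiagonal_eq_sum_range_succ
      (f := fun a b => (gCount false [] none (S.take t) a : ℤ) * if i + 2 ≤ b then (epCount (i + 1) (S.drop t) b : ℤ) else 0)]
    have hsplit : Finset.range (N + 1) = Finset.range (N - i - 1) ∪ Finset.Ico (N - i - 1) (N + 1) := by
      rw [Finset.range_eq_Ico, Finset.range_eq_Ico, Finset.Ico_union_Ico_eq_Ico (Nat.zero_le _) (by omega)]
    rw [hsplit, Finset.sum_union (Finset.disjoint_left.2 fun a ha hb => by
      rw [Finset.mem_range] at ha; rw [Finset.mem_Ico] at hb; omega)]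
    rw [Finset.sum_eq_zero (s := Finset.Ico (N - i - 1) (N + 1)) fun a ha => by
      rw [Finset.mem_Ico] at ha; rw [if_neg (by omega), mul_zero], add_zero]
    refine Finset.sum_congr rfl fun ℓ hℓ => ?_
    rw [Finset.mem_range] at hℓ
    rw [if_pos (by omega)]
  · refine (Finset.sum_eq_zero fun t _ => Finset.sum_eq_zero fun p hp => ?_).symm
    rw [Finset.mem_antidiagonal] at hp
    rw [if_neg (by omega), mul_zero]

/-- **`eS = epS 0`**: arch configurations have at least two points and a core point at the bottom. [folklore] -/
theorem eS_eq_epS_zero (S : List Bool) : eS S = epS 0 S := by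
  ext N
  rw [coeff_eS, coeff_epS]
  split_ifs with h
  · rw [epCount_zero_eq]
  · rcases N with _ | _ | N
    · rw [eCount_zero]; simp
    · rw [eCount_one]; simp
    · omega

end Summit.CriticalPhenomena.PercolationContinuityZ3.Theorems.Pcint.ChordDiag
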